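import Summits.NavierStokesRegularity.NavierStokesRegularity.Theses.AxisymmetricExtremality
import Summits.NavierStokesRegularity.NavierStokesRegularity.Theorems.AxisymmetricExtremalityAxisymmetricKatoGlobalStubSereginLogSwirlOriginStep4AssemblySwirl
import HarnessLib

/-!
# Seregin 2022, §2 Step 4 (assembly, III): the poloidal and swirl parts of `∫_{Q(R)}|v|³` on the
# parabolic cylinders `Q(R)` — crux stmt-NavierStokesRegularity-15453 (`AxisymmetricExtremality.AxisymmetricKatoGlobal`), line registered, support for stub `stub_sereginLogSwirlOrigin`

Support file (`--supports stmt-NavierStokesRegularity-15453`; theorems only, everything proved)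
toward the registered stub `stub_sereginLogSwirlOrigin` = the named fact
`Literature.Analysis.FluidPDE.seregin2022_logSwirl_regularAtOrigin` (G. Seregin, J. Math. Fluid
Mech. 24 (2022), Paper 27 = arXiv:2201.00153, §2).  Third file of the Step-4 assembly: the slice
bounds of `…Step4AssemblyPoloidal.lean` ((2.8), rate `R^{3/2}`) and `…Step4AssemblySwirl.lean`
(the `v_θ` passage, gain `R^{13/3}`) are integrated over the time window `]-R², 0[ ⊆ ]t₁, 0[` of
`Q(R) = ]-R², 0[ × 𝒞(R)` (`SereginSverak2009.parCyl 0 R`), and the swirl part is closed by Hölder on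
`Q(R)` as printed: "`R⁻²∫_{Q(R)}|v_θ|³ ≤ cR^{-3/2}[∫_{Q(R)}|v_θ|^{10/3}]^{9/10} ≤ … ≤
cR^{(10/3+1)9/10 − 3/2}[…]^{9/10} → 0`" (arXiv p. 7, last display):

* `parCyl_zero_eq_prod`, `setLIntegral_parCyl_le_lintegral_lintegral` (Tonelli upper bound on
  `Q(R)`, no measurability), `volume_parCyl_le_rpow` (`|Q(R)| ≤ 8|B₁|R⁵`), `spaceCyl_zero_mono`,
  `aemeasurable_swirlVelocity_uncurry` (`v_θ` is a.e.-measurable in space–time where `v` is);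
* `setLIntegral_parCyl_enorm_swirlVelocity_rpow_le` — `∫_{Q(R)}|v_θ|^{10/3} ≤ M₂R^{13/3}`;
* `setLIntegral_parCyl_enorm_swirlVelocity_pow_three_le` (registered; hypothesis form `…_le'`) —
  **`∫_{Q(R)}|v_θ|³ ≤ C_sw R^{22/5}`**;
* `setLIntegral_parCyl_enorm_poloidal_pow_three_le` (registered; hypothesis form `…_le'`) —
  **`∫_{Q(R)}|v̄|³ ≤ C_pol R^{7/2}`**.

The final assembly `C(R) ≤ C R^{3/2}`, `C(R) → 0` is the sibling file `…Step4Assembly.lean`.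

## References

* G. Seregin, J. Math. Fluid Mech. 24 (2022), Paper No. 27 = arXiv:2201.00153, §2 Step 4 (arXiv
  p. 7: (2.8) and the last display). [`Seregin2022LocalAxisym`]
-/

noncomputable section

open Set MeasureTheory Filter Topology Function Metric
open scoped ENNReal NNReal RealInnerProductSpace
open Literature.Analysis.FluidPDE

-- `<Problem> = <Summit>` duplicates a namespace component by design (lakefile sets the same option).
set_option linter.dupNamespace false

namespace Summit.NavierStokesRegularity.NavierStokesRegularity.Theorems.AxisymmetricKatoGlobal.EulerScaling

/-! ### Space–time bookkeeping on `Q(R) = ]-R², 0[ × 𝒞(R)` -/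

section SpaceTime

/-- The spatial cylinders about the origin increase with the radius. [folklore] -/
theorem spaceCyl_zero_mono {R R' : ℝ} (h : R ≤ R') :
    SereginSverak2009.spaceCyl (0 : EuclideanSpace ℝ (Fin 3)) R ⊆ SereginSverak2009.spaceCyl 0 R' :=
  fun _ hx => ⟨hx.1.trans_le h, hx.2.trans_le h⟩

/-- `Q(R) = ]-R², 0[ × 𝒞(R)` as a product set. [folklore] -/
theorem parCyl_zero_eq_prod (R : ℝ) :
    SereginSverak2009.parCyl (0 : ℝ × EuclideanSpace ℝ (Fin 3)) R =
      Ioo (-R ^ 2) 0 ×ˢ SereginSverak2009.spaceCyl (0 : EuclideanSpace ℝ (Fin 3)) R := by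
  ext z
  simp only [SereginSverak2009.mem_parCyl_zero, mem_prod, SereginSverak2009.mem_spaceCyl, sub_zero,
    PiLp.zero_apply]

/-- **Tonelli on `Q(R)`, upper bound** (no measurability): `∫_{Q(R)} F ≤ ∫_{-R²}^0 ∫_{𝒞(R)} F(t, ·) dt`.
[folklore] -/
theorem setLIntegral_parCyl_le_lintegral_lintegral (F : ℝ × EuclideanSpace ℝ (Fin 3) → ℝ≥0∞)
    (R : ℝ) : ∫⁻ z in SereginSverak2009.parCyl 0 R, F z ≤
      ∫⁻ t in Ioo (-R ^ 2) 0, ∫⁻ x in SereginSverak2009.spaceCyl 0 R, F (t, x) := by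
  rw [parCyl_zero_eq_prod, Measure.volume_eq_prod, ← Measure.prod_restrict]
  exact lintegral_prod_le _

/-- `|Q(R)| ≤ 8|B₁| R⁵`. [folklore] -/
theorem volume_parCyl_le_rpow {R : ℝ} (hR : 0 < R) :
    volume (SereginSverak2009.parCyl (0 : ℝ × EuclideanSpace ℝ (Fin 3)) R) ≤
      8 * volume (ball (0 : EuclideanSpace ℝ (Fin 3)) 1) * ENNReal.ofReal R ^ (5 : ℝ) := by
  rw [parCyl_zero_eq_prod, Measure.volume_eq_prod, Measure.prod_prod, Real.volume_Ioo,
    show (0 : ℝ) - -R ^ 2 = R ^ 2 by ring]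
  calc ENNReal.ofReal (R ^ 2) * volume (SereginSverak2009.spaceCyl (0 : EuclideanSpace ℝ (Fin 3)) R)
      ≤ ENNReal.ofReal (R ^ 2) * (8 * volume (ball (0 : EuclideanSpace ℝ (Fin 3)) 1) *
          ENNReal.ofReal R ^ (3 : ℝ)) := mul_le_mul' le_rfl (volume_spaceCyl_le_rpow hR)
    _ = _ := by
        rw [ENNReal.ofReal_pow hR.le, ← ENNReal.rpow_natCast, show ((2 : ℕ) : ℝ) = 2 by norm_num,
          show (5 : ℝ) = 2 + 3 by norm_num,
          ENNReal.rpow_add _ _ (ENNReal.ofReal_pos.2 hR).ne' ENNReal.ofReal_ne_top]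
        ring

/-- **The swirl velocity of a space–time field is a.e.-measurable** where the field is
a.e.-strongly measurable (`u_θ = r⁻¹(x₀u₁ − x₁u₀)` with the tree's junk value `0` on the axis).
[folklore] -/
theorem aemeasurable_swirlVelocity_uncurry
    {v : ℝ → EuclideanSpace ℝ (Fin 3) → EuclideanSpace ℝ (Fin 3)}
    {μ : Measure (ℝ × EuclideanSpace ℝ (Fin 3))} (hv : AEStronglyMeasurable (uncurry v) μ) :
    AEMeasurable (fun z : ℝ × EuclideanSpace ℝ (Fin 3) => swirlVelocity (v z.1) z.2) μ := by
  have he : (fun z : ℝ × EuclideanSpace ℝ (Fin 3) => swirlVelocity (v z.1) z.2) =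
      fun z => (cylRadius z.2)⁻¹ * (z.2 0 * (uncurry v z) 1 - z.2 1 * (uncurry v z) 0) := by
    funext z
    rw [SereginZajaczkowski2007.swirlVelocity_eq_inv_mul_swirl]
    rfl
  rw [he]
  have h0 : AEMeasurable (fun z : ℝ × EuclideanSpace ℝ (Fin 3) => (uncurry v z) 0) μ :=
    ((EuclideanSpace.proj (0 : Fin 3)).continuous.comp_aestronglyMeasurable hv).aemeasurable
  have h1 : AEMeasurable (fun z : ℝ × EuclideanSpace ℝ (Fin 3) => (uncurry v z) 1) μ :=
    ((EuclideanSpace.proj (1 : Fin 3)).continuous.comp_aestronglyMeasurable hv).aemeasurable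
  have hc0 : Measurable fun z : ℝ × EuclideanSpace ℝ (Fin 3) => z.2 0 :=
    (EuclideanSpace.proj (𝕜 := ℝ) (0 : Fin 3)).measurable.comp measurable_snd
  have hc1 : Measurable fun z : ℝ × EuclideanSpace ℝ (Fin 3) => z.2 1 :=
    (EuclideanSpace.proj (𝕜 := ℝ) (1 : Fin 3)).measurable.comp measurable_snd
  have hr : Measurable fun z : ℝ × EuclideanSpace ℝ (Fin 3) => (cylRadius z.2)⁻¹ :=
    (continuous_cylRadius.measurable.comp measurable_snd).inv
  exact hr.aemeasurable.mul ((hc0.aemeasurable.mul h1).sub (hc1.aemeasurable.mul h0))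

end SpaceTime

/-! ### The two parts on `Q(R)` -/

section Parts

variable {v : ℝ → EuclideanSpace ℝ (Fin 3) → EuclideanSpace ℝ (Fin 3)} {ζ : EuclideanSpace ℝ (Fin 3) → ℝ}
  {U : Set (EuclideanSpace ℝ (Fin 3))} {t₁ r₁ Cζ L : ℝ} {K A : ℝ≥0} {M : ℝ≥0∞}

/-- **`∫_{Q(R)} |v_θ|^{10/3} ≤ 2^{17/3}(M + (C_ζL)^{10/3}·2|B₁(ℝ²)|) R^{13/3}`** (Seregin:
"`≤ c R^{(10/3 + 1)}[∫∫ sup|v_θη³/r|^{10/3} r dr dt]`"): the slice bound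
`setLIntegral_spaceCyl_enorm_swirlVelocity_rpow_le` integrated over `]-R², 0[ ⊆ ]t₁, 0[`, with
`M ≥ ∫_{t₁}^0∫|ζΦ|^{10/3}` and `R ≤ 1`. [cite: Seregin2022LocalAxisym, §2 Step 4 (arXiv:2201.00153 p. 7), the `v_θ` passage] -/
theorem setLIntegral_parCyl_enorm_swirlVelocity_rpow_le
    (hv : ∀ t ∈ Ioo t₁ 0, ContDiff ℝ 3 (v t)) (hax : ∀ t ∈ Ioo t₁ 0, IsAxisymmetric (v t))
    (hζ : ContDiff ℝ 1 ζ) (hζ1 : tsupport ζ ⊆ SereginSverak2009.spaceCyl 0 1)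
    (hCζ : ∀ x, ‖fderiv ℝ ζ x‖ ≤ Cζ) (hLv : ∀ t ∈ Ioo t₁ 0, ∀ x, fderiv ℝ ζ x ≠ 0 → ‖v t x‖ ≤ L)
    (hM : ∫⁻ t in Ioo t₁ 0, ∫⁻ x, ‖ζ x * radVelQuot (curl (v t)) x‖ₑ ^ (10 / 3 : ℝ) ≤ M)
    (hζr₁ : ∀ x ∈ SereginSverak2009.spaceCyl 0 r₁, ζ x = 1)
    {R : ℝ} (hR : 0 < R) (hRr₁ : R ≤ r₁) (hR1 : R ≤ 1) (hRt : t₁ ≤ -R ^ 2) :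
    ∫⁻ z in SereginSverak2009.parCyl 0 R, ‖swirlVelocity (v z.1) z.2‖ₑ ^ (10 / 3 : ℝ) ≤
      2 ^ (17 / 3 : ℝ) * (M + (ENNReal.ofReal Cζ * ENNReal.ofReal L) ^ (10 / 3 : ℝ) *
        (2 * volume (ball (0 : EuclideanSpace ℝ (Fin 2)) 1))) * ENNReal.ofReal R ^ (13 / 3 : ℝ) := by
  set ρ : ℝ≥0∞ := ENNReal.ofReal R with hρ
  have hρ0 : ρ ≠ 0 := (ENNReal.ofReal_pos.2 hR).ne'
  have hρt : ρ ≠ ∞ := ENNReal.ofReal_ne_top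
  have hρ1 : ρ ≤ 1 := ENNReal.ofReal_le_one.2 hR1
  have hpow : ∀ a b : ℝ, ρ ^ a * ρ ^ b = ρ ^ (a + b) := fun a b => (ENNReal.rpow_add a b hρ0 hρt).symm
  set c : ℝ≥0∞ := ENNReal.ofReal Cζ * ENNReal.ofReal L with hc
  set V₂ : ℝ≥0∞ := 2 * volume (ball (0 : EuclideanSpace ℝ (Fin 2)) 1) with hV₂
  set P : ℝ → ℝ≥0∞ := fun t => ∫⁻ x, ‖ζ x * radVelQuot (curl (v t)) x‖ₑ ^ (10 / 3 : ℝ) with hP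
  have hζR : ∀ x ∈ SereginSverak2009.spaceCyl 0 R, ζ x = 1 := fun x hx =>
    hζr₁ x (spaceCyl_zero_mono hRr₁ hx)
  have hsub : Ioo (-R ^ 2) 0 ⊆ Ioo t₁ 0 := Ioo_subset_Ioo_left hRt
  -- slice bound, uniformly in `t ∈ ]-R², 0[`
  have hslice : ∀ t ∈ Ioo (-R ^ 2) 0,
      ∫⁻ x in SereginSverak2009.spaceCyl 0 R, ‖swirlVelocity (v t) x‖ₑ ^ (10 / 3 : ℝ) ≤
        2 ^ (10 / 3 : ℝ) * ρ * (2 ^ (10 / 3 - 1 : ℝ) *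
          (ρ ^ (10 / 3 : ℝ) * P t + c ^ (10 / 3 : ℝ) * (V₂ * ρ ^ (2 : ℝ)))) := fun t ht =>
    setLIntegral_spaceCyl_enorm_swirlVelocity_rpow_le' (hax t (hsub ht)) (hv t (hsub ht)) hζ hζ1 hCζ
      (hLv t (hsub ht)) (by norm_num) hR hR1 hζR
  have h2t : (2 : ℝ≥0∞) ^ (10 / 3 : ℝ) * ρ ≠ ∞ :=
    ENNReal.mul_ne_top (ENNReal.rpow_ne_top_of_nonneg (by norm_num) ENNReal.ofNat_ne_top) hρt
  have h2t' : (2 : ℝ≥0∞) ^ (10 / 3 - 1 : ℝ) ≠ ∞ :=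
    ENNReal.rpow_ne_top_of_nonneg (by norm_num) ENNReal.ofNat_ne_top
  have hρp : ρ ^ (10 / 3 : ℝ) ≠ ∞ := ENNReal.rpow_ne_top_of_nonneg (by norm_num) hρt
  have hPM : ∫⁻ t in Ioo (-R ^ 2) 0, P t ≤ M := (lintegral_mono_set hsub).trans hM
  calc ∫⁻ z in SereginSverak2009.parCyl 0 R, ‖swirlVelocity (v z.1) z.2‖ₑ ^ (10 / 3 : ℝ)
      ≤ ∫⁻ t in Ioo (-R ^ 2) 0, ∫⁻ x in SereginSverak2009.spaceCyl 0 R,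
          ‖swirlVelocity (v t) x‖ₑ ^ (10 / 3 : ℝ) :=
        setLIntegral_parCyl_le_lintegral_lintegral (fun z => ‖swirlVelocity (v z.1) z.2‖ₑ ^ (10 / 3 : ℝ)) R
    _ ≤ ∫⁻ t in Ioo (-R ^ 2) 0, 2 ^ (10 / 3 : ℝ) * ρ * (2 ^ (10 / 3 - 1 : ℝ) *
          (ρ ^ (10 / 3 : ℝ) * P t + c ^ (10 / 3 : ℝ) * (V₂ * ρ ^ (2 : ℝ)))) :=
        setLIntegral_mono' measurableSet_Ioo hslice
    _ = 2 ^ (10 / 3 : ℝ) * ρ * (2 ^ (10 / 3 - 1 : ℝ) *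
          (ρ ^ (10 / 3 : ℝ) * (∫⁻ t in Ioo (-R ^ 2) 0, P t) +
            c ^ (10 / 3 : ℝ) * (V₂ * ρ ^ (2 : ℝ)) * ρ ^ (2 : ℝ))) := by
        rw [lintegral_const_mul' _ _ h2t, lintegral_const_mul' _ _ h2t', lintegral_add_right _
          measurable_const, lintegral_const_mul' _ _ hρp, lintegral_const, Measure.restrict_apply_univ,
          Real.volume_Ioo, show (0 : ℝ) - -R ^ 2 = R ^ 2 by ring, ENNReal.ofReal_pow hR.le,
          ← ENNReal.rpow_natCast, show ((2 : ℕ) : ℝ) = 2 by norm_num]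
    _ ≤ 2 ^ (10 / 3 : ℝ) * ρ * (2 ^ (10 / 3 - 1 : ℝ) *
          (ρ ^ (10 / 3 : ℝ) * M + c ^ (10 / 3 : ℝ) * (V₂ * ρ ^ (2 : ℝ)) * ρ ^ (2 : ℝ))) :=
        mul_le_mul' le_rfl (mul_le_mul' le_rfl (add_le_add (mul_le_mul' le_rfl hPM) le_rfl))
    _ = 2 ^ (17 / 3 : ℝ) * (M * ρ ^ (13 / 3 : ℝ) + c ^ (10 / 3 : ℝ) * V₂ * ρ ^ (5 : ℝ)) := by
        have e2 : (2 : ℝ≥0∞) ^ (10 / 3 : ℝ) * 2 ^ (10 / 3 - 1 : ℝ) = 2 ^ (17 / 3 : ℝ) := by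
          rw [← ENNReal.rpow_add _ _ two_ne_zero ENNReal.ofNat_ne_top]; norm_num
        have e1 : ρ * ρ ^ (10 / 3 : ℝ) = ρ ^ (13 / 3 : ℝ) := by
          rw [show (13 / 3 : ℝ) = 1 + 10 / 3 by norm_num, ← hpow, ENNReal.rpow_one]
        have e5 : ρ * (ρ ^ (2 : ℝ) * ρ ^ (2 : ℝ)) = ρ ^ (5 : ℝ) := by
          rw [show (5 : ℝ) = 1 + (2 + 2) by norm_num, ← hpow, ← hpow, ENNReal.rpow_one]
        calc 2 ^ (10 / 3 : ℝ) * ρ * (2 ^ (10 / 3 - 1 : ℝ) *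
              (ρ ^ (10 / 3 : ℝ) * M + c ^ (10 / 3 : ℝ) * (V₂ * ρ ^ (2 : ℝ)) * ρ ^ (2 : ℝ)))
            = 2 ^ (10 / 3 : ℝ) * 2 ^ (10 / 3 - 1 : ℝ) *
                (M * (ρ * ρ ^ (10 / 3 : ℝ)) + c ^ (10 / 3 : ℝ) * V₂ * (ρ * (ρ ^ (2 : ℝ) * ρ ^ (2 : ℝ)))) := by
              ring
          _ = _ := by rw [e2, e1, e5]
    _ ≤ 2 ^ (17 / 3 : ℝ) * (M * ρ ^ (13 / 3 : ℝ) + c ^ (10 / 3 : ℝ) * V₂ * ρ ^ (13 / 3 : ℝ)) :=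
        mul_le_mul' le_rfl (add_le_add le_rfl (mul_le_mul' le_rfl
          (ENNReal.rpow_le_rpow_of_exponent_ge hρ1 (by norm_num : (13 / 3 : ℝ) ≤ 5))))
    _ = _ := by ring

/-- **`∫_{Q(R)} |v_θ|³ ≤ (8|B₁|)^{1/10} (2^{17/3}(M + …))^{9/10} R^{22/5}`** (Seregin:
"`R⁻²∫_{Q(R)}|v_θ|³ ≤ cR^{-3/2}[∫_{Q(R)}|v_θ|^{10/3}]^{9/10} ≤ … → 0`"; Hölder on `Q(R)`, `|Q(R)| ≤ 8|B₁|R⁵`).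
[cite: Seregin2022LocalAxisym, §2 Step 4 (arXiv:2201.00153 p. 7), last display] -/
theorem setLIntegral_parCyl_enorm_swirlVelocity_pow_three_le'
    (hmeas : AEStronglyMeasurable (uncurry v) (volume.restrict (SereginSverak2009.parCyl 0 r₁)))
    (hv : ∀ t ∈ Ioo t₁ 0, ContDiff ℝ 3 (v t)) (hax : ∀ t ∈ Ioo t₁ 0, IsAxisymmetric (v t))
    (hζ : ContDiff ℝ 1 ζ) (hζ1 : tsupport ζ ⊆ SereginSverak2009.spaceCyl 0 1)
    (hCζ : ∀ x, ‖fderiv ℝ ζ x‖ ≤ Cζ) (hLv : ∀ t ∈ Ioo t₁ 0, ∀ x, fderiv ℝ ζ x ≠ 0 → ‖v t x‖ ≤ L)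
    (hM : ∫⁻ t in Ioo t₁ 0, ∫⁻ x, ‖ζ x * radVelQuot (curl (v t)) x‖ₑ ^ (10 / 3 : ℝ) ≤ M)
    (hζr₁ : ∀ x ∈ SereginSverak2009.spaceCyl 0 r₁, ζ x = 1)
    {R : ℝ} (hR : 0 < R) (hRr₁ : R ≤ r₁) (hR1 : R ≤ 1) (hRt : t₁ ≤ -R ^ 2) :
    ∫⁻ z in SereginSverak2009.parCyl 0 R, ‖swirlVelocity (v z.1) z.2‖ₑ ^ (3 : ℕ) ≤
      (8 * volume (ball (0 : EuclideanSpace ℝ (Fin 3)) 1)) ^ (1 / 10 : ℝ) *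
        (2 ^ (17 / 3 : ℝ) * (M + (ENNReal.ofReal Cζ * ENNReal.ofReal L) ^ (10 / 3 : ℝ) *
          (2 * volume (ball (0 : EuclideanSpace ℝ (Fin 2)) 1)))) ^ (9 / 10 : ℝ) *
        ENNReal.ofReal R ^ (22 / 5 : ℝ) := by
  set ρ : ℝ≥0∞ := ENNReal.ofReal R with hρ
  have hρ0 : ρ ≠ 0 := (ENNReal.ofReal_pos.2 hR).ne'
  have hρt : ρ ≠ ∞ := ENNReal.ofReal_ne_top
  set μ : Measure (ℝ × EuclideanSpace ℝ (Fin 3)) := volume.restrict (SereginSverak2009.parCyl 0 R)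
    with hμ
  have hmono : SereginSverak2009.parCyl (0 : ℝ × EuclideanSpace ℝ (Fin 3)) R ⊆
      SereginSverak2009.parCyl 0 r₁ := SereginSverak2009.parCyl_mono 0 hR.le hRr₁
  have hθm : AEMeasurable (fun z : ℝ × EuclideanSpace ℝ (Fin 3) => ‖swirlVelocity (v z.1) z.2‖ₑ) μ :=
    (aemeasurable_swirlVelocity_uncurry (hmeas.mono_measure (Measure.restrict_mono hmono le_rfl))).enorm
  have hH := lintegral_rpow_three_le_of_tenThirds μ hθm
  rw [hμ, Measure.restrict_apply_univ] at hH
  have e3 : ∀ z : ℝ × EuclideanSpace ℝ (Fin 3), ‖swirlVelocity (v z.1) z.2‖ₑ ^ (3 : ℕ) =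
      ‖swirlVelocity (v z.1) z.2‖ₑ ^ (3 : ℝ) := fun z => (ENNReal.rpow_ofNat _ 3).symm
  simp only [e3]
  refine hH.trans ?_
  have hS := setLIntegral_parCyl_enorm_swirlVelocity_rpow_le hv hax hζ hζ1 hCζ hLv hM hζr₁ hR hRr₁
    hR1 hRt
  calc volume (SereginSverak2009.parCyl (0 : ℝ × EuclideanSpace ℝ (Fin 3)) R) ^ (1 / 10 : ℝ) *
        (∫⁻ z in SereginSverak2009.parCyl 0 R, ‖swirlVelocity (v z.1) z.2‖ₑ ^ (10 / 3 : ℝ)) ^ (9 / 10 : ℝ)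
      ≤ (8 * volume (ball (0 : EuclideanSpace ℝ (Fin 3)) 1) * ρ ^ (5 : ℝ)) ^ (1 / 10 : ℝ) *
          (2 ^ (17 / 3 : ℝ) * (M + (ENNReal.ofReal Cζ * ENNReal.ofReal L) ^ (10 / 3 : ℝ) *
            (2 * volume (ball (0 : EuclideanSpace ℝ (Fin 2)) 1))) * ρ ^ (13 / 3 : ℝ)) ^ (9 / 10 : ℝ) := by
        gcongr
        exact volume_parCyl_le_rpow hR
    _ = _ := by
        rw [ENNReal.mul_rpow_of_nonneg _ _ (by norm_num : (0 : ℝ) ≤ 1 / 10),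
          ENNReal.mul_rpow_of_nonneg _ (ρ ^ (13 / 3 : ℝ)) (by norm_num : (0 : ℝ) ≤ 9 / 10),
          ← ENNReal.rpow_mul, ← ENNReal.rpow_mul,
          show (5 : ℝ) * (1 / 10) = 1 / 2 by norm_num, show (13 / 3 : ℝ) * (9 / 10) = 39 / 10 by norm_num,
          show (22 / 5 : ℝ) = 1 / 2 + 39 / 10 by norm_num, ENNReal.rpow_add _ _ hρ0 hρt]
        ring

/-- **`∫_{Q(R)} |v̄|³ ≤ (8|B₁|)^{1/2} (C_S⁶(2K + 12C_ζ²A)³)^{1/2} R^{7/2}`** (Seregin's (2.8),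
`R⁻²∫_{Q(R)}|v̄|³ ≤ cR^γ(…)`, here `γ = 3/2`): the slice bound
`setLIntegral_spaceCyl_enorm_poloidal_rpow_three_le` integrated over `]-R², 0[ ⊆ ]t₁, 0[`.
[cite: Seregin2022LocalAxisym, §2 Step 4 (arXiv:2201.00153 p. 7), (2.8)] -/
theorem setLIntegral_parCyl_enorm_poloidal_pow_three_le'
    (hv : ∀ t ∈ Ioo t₁ 0, ContDiff ℝ 4 (v t)) (hax : ∀ t ∈ Ioo t₁ 0, IsAxisymmetric (v t))
    (hζ : ContDiff ℝ 2 ζ) (hU : IsOpen U) (hζU : tsupport ζ ⊆ U)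
    (hζ1 : tsupport ζ ⊆ SereginSverak2009.spaceCyl 0 1)
    (hdiv : ∀ t ∈ Ioo t₁ 0, ∀ y ∈ U, VectorCalculus.divergence (v t) y = 0)
    (hCζ : ∀ x, ‖fderiv ℝ ζ x‖ ≤ Cζ)
    (hΓ : ∀ t ∈ Ioo t₁ 0, ∫⁻ x, ‖ζ x * angVortQuot (v t) x‖ₑ ^ 2 ≤ K)
    (hA : ∀ t ∈ Ioo t₁ 0, ∫⁻ x in SereginSverak2009.spaceCyl 0 1, ‖v t x‖ₑ ^ 2 ≤ A)
    (hζr₁ : ∀ x ∈ SereginSverak2009.spaceCyl 0 r₁, ζ x = 1)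
    {R : ℝ} (hR : 0 < R) (hRr₁ : R ≤ r₁) (hRt : t₁ ≤ -R ^ 2) :
    ∫⁻ z in SereginSverak2009.parCyl 0 R, ‖v z.1 z.2 - angVelQuot (v z.1) z.2 • rotGen z.2‖ₑ ^ (3 : ℕ) ≤
      (8 * volume (ball (0 : EuclideanSpace ℝ (Fin 3)) 1)) ^ (1 / 2 : ℝ) *
        ((eLpNormLESNormFDerivOfEqInnerConst (volume : Measure (EuclideanSpace ℝ (Fin 3))) 2 : ℝ≥0∞)
          ^ (6 : ℝ) * (2 * K + 12 * ENNReal.ofReal (Cζ ^ 2) * A) ^ (3 : ℝ)) ^ (1 / 2 : ℝ) *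
        ENNReal.ofReal R ^ (7 / 2 : ℝ) := by
  set ρ : ℝ≥0∞ := ENNReal.ofReal R with hρ
  have hρ0 : ρ ≠ 0 := (ENNReal.ofReal_pos.2 hR).ne'
  have hρt : ρ ≠ ∞ := ENNReal.ofReal_ne_top
  set Y : ℝ≥0∞ := ((eLpNormLESNormFDerivOfEqInnerConst (volume : Measure (EuclideanSpace ℝ (Fin 3))) 2
    : ℝ≥0∞) ^ (6 : ℝ) * (2 * K + 12 * ENNReal.ofReal (Cζ ^ 2) * A) ^ (3 : ℝ)) with hY
  set V₃ : ℝ≥0∞ := 8 * volume (ball (0 : EuclideanSpace ℝ (Fin 3)) 1) with hV₃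
  have hζR : ∀ x ∈ SereginSverak2009.spaceCyl 0 R, ζ x = 1 := fun x hx =>
    hζr₁ x (spaceCyl_zero_mono hRr₁ hx)
  have hsub : Ioo (-R ^ 2) 0 ⊆ Ioo t₁ 0 := Ioo_subset_Ioo_left hRt
  have hslice : ∀ t ∈ Ioo (-R ^ 2) 0, ∫⁻ x in SereginSverak2009.spaceCyl 0 R,
      ‖v t x - angVelQuot (v t) x • rotGen x‖ₑ ^ (3 : ℕ) ≤
        (V₃ * ρ ^ (3 : ℝ)) ^ (1 / 2 : ℝ) * Y ^ (1 / 2 : ℝ) := fun t ht =>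
    setLIntegral_spaceCyl_enorm_poloidal_pow_three_le' (hax t (hsub ht)) (hv t (hsub ht)) hζ hU hζU hζ1
      (hdiv t (hsub ht)) hCζ (hΓ t (hsub ht)) (hA t (hsub ht)) hR hζR
  calc ∫⁻ z in SereginSverak2009.parCyl 0 R, ‖v z.1 z.2 - angVelQuot (v z.1) z.2 • rotGen z.2‖ₑ ^ (3 : ℕ)
      ≤ ∫⁻ t in Ioo (-R ^ 2) 0, ∫⁻ x in SereginSverak2009.spaceCyl 0 R,
          ‖v t x - angVelQuot (v t) x • rotGen x‖ₑ ^ (3 : ℕ) :=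
        setLIntegral_parCyl_le_lintegral_lintegral
          (fun z => ‖v z.1 z.2 - angVelQuot (v z.1) z.2 • rotGen z.2‖ₑ ^ (3 : ℕ)) R
    _ ≤ ∫⁻ t in Ioo (-R ^ 2) 0, (V₃ * ρ ^ (3 : ℝ)) ^ (1 / 2 : ℝ) * Y ^ (1 / 2 : ℝ) :=
        setLIntegral_mono' measurableSet_Ioo hslice
    _ = (V₃ * ρ ^ (3 : ℝ)) ^ (1 / 2 : ℝ) * Y ^ (1 / 2 : ℝ) * ρ ^ (2 : ℝ) := by
        rw [setLIntegral_const, Real.volume_Ioo, show (0 : ℝ) - -R ^ 2 = R ^ 2 by ring,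
          ENNReal.ofReal_pow hR.le, ← ENNReal.rpow_natCast, show ((2 : ℕ) : ℝ) = 2 by norm_num]
    _ = _ := by
        rw [ENNReal.mul_rpow_of_nonneg _ _ (by norm_num : (0 : ℝ) ≤ 1 / 2), ← ENNReal.rpow_mul,
          show (3 : ℝ) * (1 / 2) = 3 / 2 by norm_num, show (7 / 2 : ℝ) = 3 / 2 + 2 by norm_num,
          ENNReal.rpow_add _ _ hρ0 hρt]
        ring

/-- **The swirl part of `C(R)` on `Q(R)`, Seregin 2022 §2 Step 4** (registered form of
`setLIntegral_parCyl_enorm_swirlVelocity_pow_three_le'`): on a slab `]t₁, 0[` of axisymmetric `C³`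
slices, measurable in space–time on `Q(r₁)`, with a `C¹` cut-off `ζ` (`tsupport ζ ⊆ 𝒞`, `‖Dζ‖ ≤ C_ζ`,
`ζ = 1` on `𝒞(r₁)`), `|v| ≤ L` on `supp Dζ`, and `∫_{t₁}^0∫|ζΦ|^{10/3} ≤ M`: for
`0 < R ≤ min(r₁, 1)` with `R² ≤ |t₁|`,
`∫_{Q(R)}|v_θ|³ ≤ (8|B₁|)^{1/10}(2^{17/3}(M + (C_ζL)^{10/3}2|B₁(ℝ²)|))^{9/10} R^{22/5}`.
[cite: Seregin2022LocalAxisym, §2 Step 4 (arXiv:2201.00153 p. 7), last display] -/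
theorem setLIntegral_parCyl_enorm_swirlVelocity_pow_three_le : ∀ (v : ℝ → EuclideanSpace ℝ (Fin 3) → EuclideanSpace ℝ (Fin 3)) (ζ : EuclideanSpace ℝ (Fin 3) → ℝ) (t₁ r₁ Cζ L R : ℝ) (M : ℝ≥0∞), AEStronglyMeasurable (uncurry v) (volume.restrict (SereginSverak2009.parCyl 0 r₁)) → (∀ t ∈ Ioo t₁ 0, ContDiff ℝ 3 (v t)) → (∀ t ∈ Ioo t₁ 0, IsAxisymmetric (v t)) → ContDiff ℝ 1 ζ → tsupport ζ ⊆ SereginSverak2009.spaceCyl 0 1 → (∀ x, ‖fderiv ℝ ζ x‖ ≤ Cζ) → (∀ t ∈ Ioo t₁ 0, ∀ x, fderiv ℝ ζ x ≠ 0 → ‖v t x‖ ≤ L) → (∫⁻ t in Ioo t₁ 0, ∫⁻ x, ‖ζ x * radVelQuot (curl (v t)) x‖ₑ ^ (10 / 3 : ℝ) ≤ M) → (∀ x ∈ SereginSverak2009.spaceCyl 0 r₁, ζ x = 1) → 0 < R → R ≤ r₁ → R ≤ 1 → t₁ ≤ -R ^ 2 → ∫⁻ z in SereginSverak2009.parCyl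 0 R, ‖swirlVelocity (v z.1) z.2‖ₑ ^ (3 : ℕ) ≤ (8 * volume (ball (0 : EuclideanSpace ℝ (Fin 3)) 1)) ^ (1 / 10 : ℝ) * (2 ^ (17 / 3 : ℝ) * (M + (ENNReal.ofReal Cζ * ENNReal.ofReal L) ^ (10 / 3 : ℝ) * (2 * volume (ball (0 : EuclideanSpace ℝ (Fin 2)) 1)))) ^ (9 / 10 : ℝ) * ENNReal.ofReal R ^ (22 / 5 : ℝ) :=
  fun _ _ _ _ _ _ _ _ hmeas hv hax hζ hζ1 hCζ hLv hM hζr₁ hR hRr₁ hR1 hRt =>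
    setLIntegral_parCyl_enorm_swirlVelocity_pow_three_le' hmeas hv hax hζ hζ1 hCζ hLv hM hζr₁ hR hRr₁
      hR1 hRt

/-- **The poloidal part of `C(R)` on `Q(R)`, Seregin 2022 §2 Step 4, (2.8)** (registered form of
`setLIntegral_parCyl_enorm_poloidal_pow_three_le'`): on a slab `]t₁, 0[` of axisymmetric `C⁴`
slices divergence free on an open `U`, with a `C²` cut-off `ζ` (`tsupport ζ ⊆ U ∩ 𝒞`, `‖Dζ‖ ≤ C_ζ`,
`ζ = 1` on `𝒞(r₁)`), the (2.7) `sup` term `sup_t ‖ζΓ‖₂² ≤ K` and the energy class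
`sup_t ∫_𝒞|v|² ≤ A`: for `0 < R ≤ r₁` with `R² ≤ |t₁|`,
`∫_{Q(R)}|v̄|³ ≤ (8|B₁|)^{1/2}(C_S⁶(2K + 12C_ζ²A)³)^{1/2} R^{7/2}` (`v̄ = v − (v_θ/r)J`).
[cite: Seregin2022LocalAxisym, §2 Step 4 (arXiv:2201.00153 p. 7), (2.8)] -/
theorem setLIntegral_parCyl_enorm_poloidal_pow_three_le : ∀ (v : ℝ → EuclideanSpace ℝ (Fin 3) → EuclideanSpace ℝ (Fin 3)) (ζ : EuclideanSpace ℝ (Fin 3) → ℝ) (U : Set (EuclideanSpace ℝ (Fin 3))) (t₁ r₁ Cζ R : ℝ) (K A : ℝ≥0), (∀ t ∈ Ioo t₁ 0, ContDiff ℝ 4 (v t)) → (∀ t ∈ Ioo t₁ 0, IsAxisymmetric (v t)) → ContDiff ℝ 2 ζ → IsOpen U → tsupport ζ ⊆ U → tsupport ζ ⊆ SereginSverak2009.spaceCyl 0 1 → (∀ t ∈ Ioo t₁ 0, ∀ y ∈ U, VectorCalculus.divergence (v t) y = 0) → (∀ x, ‖fderiv ℝ ζ x‖ ≤ Cζ)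 → (∀ t ∈ Ioo t₁ 0, ∫⁻ x, ‖ζ x * angVortQuot (v t) x‖ₑ ^ 2 ≤ K) → (∀ t ∈ Ioo t₁ 0, ∫⁻ x in SereginSverak2009.spaceCyl 0 1, ‖v t x‖ₑ ^ 2 ≤ A) → (∀ x ∈ SereginSverak2009.spaceCyl 0 r₁, ζ x = 1) → 0 < R → R ≤ r₁ → t₁ ≤ -R ^ 2 → ∫⁻ z in SereginSverak2009.parCyl 0 R, ‖v z.1 z.2 - angVelQuot (v z.1) z.2 • rotGen z.2‖ₑ ^ (3 : ℕ) ≤ (8 * volume (ball (0 : EuclideanSpace ℝ (Fin 3)) 1)) ^ (1 / 2 : ℝ) * ((eLpNormLESNormFDerivOfEqInnerConst (volume : Measure (EuclideanSpace ℝ (Fin 3))) 2 : ℝ≥0∞) ^ (6 : ℝ) * (2 * K + 12 * ENNReal.ofReal (Cζ ^ 2) * A) ^ (3 : ℝ)) ^ (1 / 2 : ℝ) * ENNReal.ofReal R ^ (7 / 2 : ℝ) :=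
  fun _ _ _ _ _ _ _ _ _ hv hax hζ hU hζU hζ1 hdiv hCζ hΓ hA hζr₁ hR hRr₁ hRt =>
    setLIntegral_parCyl_enorm_poloidal_pow_three_le' hv hax hζ hU hζU hζ1 hdiv hCζ hΓ hA hζr₁ hR hRr₁ hRt

end Parts

end Summit.NavierStokesRegularity.NavierStokesRegularity.Theorems.AxisymmetricKatoGlobal.EulerScaling

end
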